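/-
Copyright (c) 2026 the pub-hodgecm-mathlib formalisation cell (harness21).  Prover seat hodgecm-mathlib-R90-C10-p06 (g3), R90-TF SLAB section S1 «Ch10-local» (base
R90-C10), h413 = `stmt-HodgeConjecture-24833`; line «B_pos» (U4Keys :182 in BRANCH B at positive depth, all inert places), MASTER CHAIN part 3 (second pen; dealer
R90-C10-plan (g2) 00:56:01Z (iii), lead R90-C10-p05 (g2) guidance 00:57:11Z (4)): part 3a «THE CUT-OFF REGION AS A DISJOINT UNION OF SHELLS AND THE GEOMETRIC SHELL SUM»,
hypothesis-first on the per-shell values.  2026-09-05.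
-/
import Summits.HodgeConjecture.HodgeConjecture.Theorems.K2E3BranchBShellRegions     -- ★ (K2E3-p32 (g0)): the frame v1 regions of `N(L⁺_v)` (brings the «U4-RAM» frame)
import Summits.HodgeConjecture.HodgeConjecture.Theorems.K2E3BranchBShellSeries      -- ★ (K2E3-p03 (g9)): `hasSum_neg_pow` (`Σ (−X)^m = (1 + X)⁻¹`, `‖X‖ < 1`)
import HarnessLib

/-!
# R90-TF S1 «Ch10-local» ∕ K2 E3 «U4Keys» :182, BRANCH B AT POSITIVE DEPTH — master chain part 3a: THE CUT-OFF REGION AS A DISJOINT UNION OF SHELLS, AND THE SHELL SUM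
# «if `∫_{|z| = e^{j₀+i}, |x| ≤ e^{j₀+i−ρ}} F dμ = V·(−X)^{j₀+i}` for every `i`, then `∫_{e^{j₀} ≤ |z|, |x| ≤ |ϖ|^ρ|z|} F dμ = V·(−X)^{j₀}·(1 + X)⁻¹`»
# [Keys1984 §4–§5, §7 Thm (2); Casselman1995 §6.4; Rogawski1990 §1.10; WeilBNT1967 Ch. II §5]

Cell `pub/hodgecm-mathlib`, crux H413 = `stmt-HodgeConjecture-24833`, route of record `HCCMUnconditional` (no route verbs); R90-TF section S1 (junction socket A2′ = U4Keys :217,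
REL over :155 and :182).  THEOREMS ONLY (no `def`, no `instance`, no `notation`, no named-fact hypothesis, no `sorry`); lane `--supports stmt-HodgeConjecture-24833 --as helper`,
count-neutral.  NOT THE PAYER of :182.  FRAME = the «U4-RAM» frame v1 of ★ part 2a∕part 2: `N := (cmBorelTriple L 3 v).N`, entries `z := n₀₂`, `x := n₀₁` (spelled
`((↑n : GL (Fin 3) R) : Matrix …) 0 2 ∕ 0 1`), a place `w ∣ v`, a uniformiser `ϖ` of `L_w` (`hϖ`), ANY measure `μ` on `N` and ANY function `F : N → ℂ` integrable on the cut-off region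
(no Haar, no character, no ramification hypothesis: pure σ-additivity and a geometric series).

THE POINT (lead's guidance 00:57:11Z (4)).  The cut-off region of the master integral, `C(ρ, j₀) := {n : e^{j₀} ≤ |z(n)|_w ∧ |x(n)|_w ≤ |ϖ|_w^ρ·|z(n)|_w}`, is the DISJOINT union over
`i : ℕ` of the cut shells `S_{j₀+i} := {n : |z(n)|_w = e^{j₀+i} ∧ |x(n)|_w ≤ e^{j₀+i−ρ}}` (`|z|_w ∈ {0} ∪ e^ℤ`, `|ϖ|^ρ = e^{−ρ}`), Borel by hypothesis (`hmeas`; = ★ part 2 p864003 `measurableSet_shell_cut` at the call site); so `∫_C F = Σ_i ∫_{S_{j₀+i}} F` (Mathlib `hasSum_integral_iUnion`) and a per-shell GEOMETRIC law `∫_{S_{j₀+i}} F = V·(−X)^{j₀+i}` (`‖X‖ < 1`) sums to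
`V·(−X)^{j₀}·(1 + X)⁻¹` (★ `hasSum_neg_pow`, `HasSum.unique`).  Part 3b (`R90S1BposMasterIntegral`) supplies the per-shell law from ★∕📤 part 2 + (B-5b) + (B-9c) + ★ (B-5x).
* §1 `shell_cut_disjoint`, `iUnion_shell_cut_eq_cutoff` (set theory of the shells; Borel-ness is the letter `hmeas` = ★ part 2 `measurableSet_shell_cut`);
* §2 **`setIntegral_cutoff_eq_of_shell_values`** — the shell sum, hypothesis-first on the per-shell values.
HONEST LABEL.  HC_CM is proved only modulo the 7 printed citations (2 remaining named inputs: hLiu418 = `stmt-HodgeConjecture-24832`, h413 = `stmt-HodgeConjecture-24833`) until rung 0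
closes; count-neutral — this file does NOT pay :182 or A2′; no printed citation is discharged.

## References
* [Keys1984] D. Keys, *Principal series representations of special unitary groups over local fields*, Compositio Math. 51 (1984), §4–§5, §7 Theorem (2) p. 126.
* [Casselman1995] W. Casselman, *Introduction to the theory of admissible representations of `p`-adic reductive groups* (1995), §6.4 p. 63 (shell-by-shell evaluation).
* [Rogawski1990] J. D. Rogawski, *Automorphic Representations of Unitary Groups in Three Variables*, Ann. of Math. Stud. 123 (1990), §1.10 p. 9, §12.2 (2) p. 173.
* [WeilBNT1967] A. Weil, *Basic Number Theory* (1967), Ch. II §5 (σ-additivity of integrals over level sets).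
-/

set_option autoImplicit false
-- the mandated namespace has the single-problem summit's repeated segment (`HodgeConjecture.HodgeConjecture`)
set_option linter.dupNamespace false

noncomputable section

open NumberField IsDedekindDomain MeasureTheory Measure
open scoped Matrix MatrixGroups WithZero Valued NNReal ENNReal
open Literature.NumberTheory Literature.NumberTheory.Automorphic Literature.NumberTheory.Automorphic.UnitaryGroup

namespace Summit.HodgeConjecture.HodgeConjecture.R90.S1.BposCutoffShellSum

open Summit.HodgeConjecture.HodgeConjecture.Cruxes.H413

variable (L : Type) [Field L] [NumberField L] [IsCMField L] (v : HeightOneSpectrum (𝓞 ↥(maximalRealSubfield L)))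
  (w : PlacesOver L v)

/-! ## §1 The cut shells: disjointness and the decomposition of the cut-off region -/

/-- The cut shells with different exponents are disjoint (the value `|z|_w` separates them). [cite: Rogawski1990, §1.10 p. 9] -/
theorem shell_cut_disjoint (ρ j₀ : ℕ) :
    Pairwise (Function.onFun Disjoint fun i : ℕ => ({m : ↥(cmBorelTriple L 3 v).N |
      Valued.v (((m : ↥(unitaryGroupOfForm (conjLocal L (IsCMField.complexConj L) v) (cmLocalForm L 3 v))) : GL (Fin 3) (LocalRing L v)).val 0 2 w) =
          WithZero.exp ((j₀ + i : ℕ) : ℤ) ∧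
      Valued.v (((m : ↥(unitaryGroupOfForm (conjLocal L (IsCMField.complexConj L) v) (cmLocalForm L 3 v))) : GL (Fin 3) (LocalRing L v)).val 0 1 w) ≤
          WithZero.exp (((j₀ + i : ℕ) : ℤ) - ρ)} : Set ↥(cmBorelTriple L 3 v).N)) := by
  intro i i' hii'
  rw [Function.onFun, Set.disjoint_left]
  rintro m ⟨hm1, -⟩ ⟨hm2, -⟩
  rw [hm1, WithZero.exp_inj] at hm2
  exact hii' (by omega)

/-- **The cut-off region is the union of the cut shells**: `{e^{j₀} ≤ |z|_w ∧ |x|_w ≤ |ϖ|_w^ρ·|z|_w} = ⋃_{i} {|z|_w = e^{j₀+i} ∧ |x|_w ≤ e^{j₀+i−ρ}}` (`|z|_w ∈ {0} ∪ e^ℤ`, `|ϖ|_w^ρ = e^{−ρ}`).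
[cite: Rogawski1990, §1.10 p. 9] [cite: Casselman1995, §6.4 p. 63] -/
theorem iUnion_shell_cut_eq_cutoff {ϖ : w.1.adicCompletion L} (hϖ : Valued.v ϖ = WithZero.exp (-1 : ℤ)) (ρ j₀ : ℕ) :
    (⋃ i : ℕ, {m : ↥(cmBorelTriple L 3 v).N |
      Valued.v (((((m : ↥(unitaryGroupOfForm (conjLocal L (IsCMField.complexConj L) v) (cmLocalForm L 3 v))) : GL (Fin 3) (LocalRing L v)) : Matrix (Fin 3) (Fin 3) (LocalRing L v)) 0 2) w) =
          WithZero.exp ((j₀ + i : ℕ) : ℤ) ∧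
      Valued.v (((((m : ↥(unitaryGroupOfForm (conjLocal L (IsCMField.complexConj L) v) (cmLocalForm L 3 v))) : GL (Fin 3) (LocalRing L v)) : Matrix (Fin 3) (Fin 3) (LocalRing L v)) 0 1) w) ≤
          WithZero.exp (((j₀ + i : ℕ) : ℤ) - ρ)}) =
    {n : ↥(cmBorelTriple L 3 v).N |
      WithZero.exp (j₀ : ℤ) ≤ Valued.v (((((n : ↥(unitaryGroupOfForm (conjLocal L (IsCMField.complexConj L) v) (cmLocalForm L 3 v))) : GL (Fin 3) (LocalRing L v)) : Matrix (Fin 3) (Fin 3) (LocalRing L v)) 0 2) w) ∧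
      Valued.v (((((n : ↥(unitaryGroupOfForm (conjLocal L (IsCMField.complexConj L) v) (cmLocalForm L 3 v))) : GL (Fin 3) (LocalRing L v)) : Matrix (Fin 3) (Fin 3) (LocalRing L v)) 0 1) w) ≤
        Valued.v ϖ ^ ρ * Valued.v (((((n : ↥(unitaryGroupOfForm (conjLocal L (IsCMField.complexConj L) v) (cmLocalForm L 3 v))) : GL (Fin 3) (LocalRing L v)) : Matrix (Fin 3) (Fin 3) (LocalRing L v)) 0 2) w)} := by
  have hϖρ : Valued.v ϖ ^ ρ = WithZero.exp (-(ρ : ℤ)) := by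
    rw [hϖ, ← WithZero.exp_nsmul, nsmul_eq_mul, mul_neg, mul_one]
  ext n
  simp only [Set.mem_iUnion, Set.mem_setOf_eq]
  constructor
  · rintro ⟨i, hz, hx⟩
    refine ⟨?_, ?_⟩
    · rw [hz, WithZero.exp_le_exp]; push_cast; omega
    · rw [hz, hϖρ, ← WithZero.exp_add]
      refine hx.trans (le_of_eq ?_)
      congr 1; push_cast; ring
  · rintro ⟨hz, hx⟩
    have hz0 : Valued.v (((((n : ↥(unitaryGroupOfForm (conjLocal L (IsCMField.complexConj L) v) (cmLocalForm L 3 v))) : GL (Fin 3) (LocalRing L v)) : Matrix (Fin 3) (Fin 3) (LocalRing L v)) 0 2) w) ≠ 0 :=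
      fun h => by rw [h] at hz; exact absurd hz (not_le.2 WithZero.exp_pos)
    obtain ⟨l, hl⟩ : ∃ l : ℤ, Valued.v (((((n : ↥(unitaryGroupOfForm (conjLocal L (IsCMField.complexConj L) v) (cmLocalForm L 3 v))) : GL (Fin 3) (LocalRing L v)) : Matrix (Fin 3) (Fin 3) (LocalRing L v)) 0 2) w) =
        WithZero.exp l := ⟨_, (WithZero.exp_log hz0).symm⟩
    rw [hl, WithZero.exp_le_exp] at hz
    refine ⟨(l - j₀).toNat, ?_, ?_⟩
    · rw [hl]; congr 1; push_cast; omega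
    · rw [hl, hϖρ, ← WithZero.exp_add] at hx
      refine hx.trans (le_of_eq ?_)
      congr 1; push_cast; omega

/-! ## §2 The shell sum -/

/-- **THE GEOMETRIC SHELL SUM OVER THE CUT-OFF REGION.**  For ANY measure `μ` on `N(L⁺_v)`, ANY `F : N → ℂ` integrable on the cut-off region
`C(ρ, j₀) = {e^{j₀} ≤ |z|_w ∧ |x|_w ≤ |ϖ|_w^ρ·|z|_w}`, Borel cut shells (`hmeas`, = ★ part 2 p864003 `measurableSet_shell_cut`), and constants `V X : ℂ` with `‖X‖ < 1`: if every cut shell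
`{|z|_w = e^{j₀+i} ∧ |x|_w ≤ e^{j₀+i−ρ}}` (`i : ℕ`) carries the value `V·(−X)^{j₀+i}`, then `∫_{C(ρ, j₀)} F dμ = V·(−X)^{j₀}·(1 + X)⁻¹` (§1 + Mathlib `hasSum_integral_iUnion` + ★
`hasSum_neg_pow` + `HasSum.unique`). [cite: Keys1984, §4–§5, §7 Theorem (2) p. 126] [cite: Casselman1995, §6.4 p. 63] [cite: WeilBNT1967, Ch. II §5] -/
theorem setIntegral_cutoff_eq_of_shell_values [MeasurableSpace ↥(cmBorelTriple L 3 v).N] (μ : Measure ↥(cmBorelTriple L 3 v).N)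
    {ϖ : w.1.adicCompletion L} (hϖ : Valued.v ϖ = WithZero.exp (-1 : ℤ))
    (hmeas : ∀ j t : ℤ, MeasurableSet {m : ↥(cmBorelTriple L 3 v).N |
      Valued.v (((((m : ↥(unitaryGroupOfForm (conjLocal L (IsCMField.complexConj L) v) (cmLocalForm L 3 v))) : GL (Fin 3) (LocalRing L v)) : Matrix (Fin 3) (Fin 3) (LocalRing L v)) 0 2) w) = WithZero.exp j ∧
      Valued.v (((((m : ↥(unitaryGroupOfForm (conjLocal L (IsCMField.complexConj L) v) (cmLocalForm L 3 v))) : GL (Fin 3) (LocalRing L v)) : Matrix (Fin 3) (Fin 3) (LocalRing L v)) 0 1) w) ≤ WithZero.exp t})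
    (F : ↥(cmBorelTriple L 3 v).N → ℂ) (ρ j₀ : ℕ)
    (hF : IntegrableOn F {n : ↥(cmBorelTriple L 3 v).N |
      WithZero.exp (j₀ : ℤ) ≤ Valued.v (((((n : ↥(unitaryGroupOfForm (conjLocal L (IsCMField.complexConj L) v) (cmLocalForm L 3 v))) : GL (Fin 3) (LocalRing L v)) : Matrix (Fin 3) (Fin 3) (LocalRing L v)) 0 2) w) ∧
      Valued.v (((((n : ↥(unitaryGroupOfForm (conjLocal L (IsCMField.complexConj L) v) (cmLocalForm L 3 v))) : GL (Fin 3) (LocalRing L v)) : Matrix (Fin 3) (Fin 3) (LocalRing L v)) 0 1) w) ≤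
        Valued.v ϖ ^ ρ * Valued.v (((((n : ↥(unitaryGroupOfForm (conjLocal L (IsCMField.complexConj L) v) (cmLocalForm L 3 v))) : GL (Fin 3) (LocalRing L v)) : Matrix (Fin 3) (Fin 3) (LocalRing L v)) 0 2) w)} μ)
    (V X : ℂ) (hX : ‖X‖ < 1)
    (hshell : ∀ i : ℕ, ∫ n in {m : ↥(cmBorelTriple L 3 v).N |
        Valued.v (((((m : ↥(unitaryGroupOfForm (conjLocal L (IsCMField.complexConj L) v) (cmLocalForm L 3 v))) : GL (Fin 3) (LocalRing L v)) : Matrix (Fin 3) (Fin 3) (LocalRing L v)) 0 2) w) =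
            WithZero.exp ((j₀ + i : ℕ) : ℤ) ∧
        Valued.v (((((m : ↥(unitaryGroupOfForm (conjLocal L (IsCMField.complexConj L) v) (cmLocalForm L 3 v))) : GL (Fin 3) (LocalRing L v)) : Matrix (Fin 3) (Fin 3) (LocalRing L v)) 0 1) w) ≤
            WithZero.exp (((j₀ + i : ℕ) : ℤ) - ρ)}, F n ∂μ = V * (-X) ^ (j₀ + i)) :
    ∫ n in {n : ↥(cmBorelTriple L 3 v).N |
      WithZero.exp (j₀ : ℤ) ≤ Valued.v (((((n : ↥(unitaryGroupOfForm (conjLocal L (IsCMField.complexConj L) v) (cmLocalForm L 3 v))) : GL (Fin 3) (LocalRing L v)) : Matrix (Fin 3) (Fin 3) (LocalRing L v)) 0 2) w) ∧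
      Valued.v (((((n : ↥(unitaryGroupOfForm (conjLocal L (IsCMField.complexConj L) v) (cmLocalForm L 3 v))) : GL (Fin 3) (LocalRing L v)) : Matrix (Fin 3) (Fin 3) (LocalRing L v)) 0 1) w) ≤
        Valued.v ϖ ^ ρ * Valued.v (((((n : ↥(unitaryGroupOfForm (conjLocal L (IsCMField.complexConj L) v) (cmLocalForm L 3 v))) : GL (Fin 3) (LocalRing L v)) : Matrix (Fin 3) (Fin 3) (LocalRing L v)) 0 2) w)}, F n ∂μ =
      V * (-X) ^ j₀ * (1 + X)⁻¹ := by
  rw [← iUnion_shell_cut_eq_cutoff L v w hϖ ρ j₀] at hF ⊢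
  have hsum := hasSum_integral_iUnion (μ := μ) (f := F) (fun i => hmeas ((j₀ + i : ℕ) : ℤ) (((j₀ + i : ℕ) : ℤ) - ρ))
    (shell_cut_disjoint L v w ρ j₀) hF
  have hgeo : HasSum (fun i : ℕ => V * (-X) ^ (j₀ + i)) (V * (-X) ^ j₀ * (1 + X)⁻¹) := by
    have h := (K2E3BranchBShellSeries.hasSum_neg_pow X hX).mul_left (V * (-X) ^ j₀)
    refine h.congr_fun fun i => ?_
    rw [pow_add, mul_assoc]
  have hfun : (fun i : ℕ => ∫ n in {m : ↥(cmBorelTriple L 3 v).N |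
        Valued.v (((((m : ↥(unitaryGroupOfForm (conjLocal L (IsCMField.complexConj L) v) (cmLocalForm L 3 v))) : GL (Fin 3) (LocalRing L v)) : Matrix (Fin 3) (Fin 3) (LocalRing L v)) 0 2) w) =
            WithZero.exp ((j₀ + i : ℕ) : ℤ) ∧
        Valued.v (((((m : ↥(unitaryGroupOfForm (conjLocal L (IsCMField.complexConj L) v) (cmLocalForm L 3 v))) : GL (Fin 3) (LocalRing L v)) : Matrix (Fin 3) (Fin 3) (LocalRing L v)) 0 1) w) ≤
            WithZero.exp (((j₀ + i : ℕ) : ℤ) - ρ)}, F n ∂μ) = fun i : ℕ => V * (-X) ^ (j₀ + i) := funext hshell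
  rw [hfun] at hsum
  exact hsum.unique hgeo

end Summit.HodgeConjecture.HodgeConjecture.R90.S1.BposCutoffShellSum

end
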